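/-
Copyright (c) 2026 the pub-hodgecm-mathlib formalisation cell (harness21).  Prover seat hodgecm-mathlib-K2E3-p23 (g3), Track B «K2-LIT» ∕ h413
(`stmt-HodgeConjecture-24833`), line `K2_E3_EllipticInputs`, 13a road A (line lead K2E3-p10 (g4)), item (P2a) tools.  2026-09-04.
-/
import Literature.NumberTheory.Automorphic.UnitaryGroupAutomorphicRep     -- ★ `unitaryGroupOfForm`
import Mathlib.LinearAlgebra.Matrix.NonsingularInverse
import HarnessLib

/-!
# Crux `H413` — K2-LIT E3, 13a road A (set road): entry bounds — every matrix is bounded by some `exp c`, triple products, and THE INVERSE OF A BOUNDED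
# ELEMENT OF `U(σ, W)` IS BOUNDED (`L⁻¹ = W⁻¹ σ(L)ᵀ W`)

Cell `hodgecm-mathlib`, Track B, line `K2_E3_EllipticInputs`, row 13a; seat K2E3-p23 (g3).  THEOREMS ONLY; count-neutral helper (`--supports stmt-HodgeConjecture-24833
--as helper`).  Tools for the compact-SET currency of the 13a road (RULINGS #14∕#15 of K2E3-p10 (g4)): with `Ω_C = {k ∈ U : |k_{ij}|, |k⁻¹_{ij}| ≤ C}` in place of
`K₀ = U ∩ GL_N(𝒪)` one needs the inverse bound separately; for a unitary group it is free: `L⁻¹ = W⁻¹ σ(L)ᵀ W`.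

* `exists_nat_forall_v_apply_le_exp` — `∃ c : ℕ, ∀ p q, |M_{pq}| ≤ exp c`.
* `v_mul_mul_apply_le'` — `|(XYZ)_{ij}| ≤ a b c` from entrywise bounds (ultrametric).
* `coe_inv_eq_conj_witt` — `L⁻¹ = W⁻¹ σ(L)ᵀ W` for `L ∈ U(σ, W)`, `det W` a unit; `v_inv_apply_le_of_v_apply_le` — `|L⁻¹_{ij}| ≤ c_W · B · c_W`.

HONEST LABEL: HC_CM is proved only modulo the 7 printed citations (2 remaining named inputs: hLiu418 = stmt-HodgeConjecture-24832, h413 = stmt-HodgeConjecture-24833) until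
rung 0 closes; elementary, closes no organ by itself.

References: J. Rogawski, *Automorphic Representations of Unitary Groups in Three Variables* (1990), §1.9 [Rogawski1990]; F. Bruhat, J. Tits (1972), (4.4.3)
[BruhatTits1972]; I. G. Macdonald (1995), Ch. V §2 [Macdonald1995].
-/

set_option autoImplicit false
set_option linter.dupNamespace false

noncomputable section

open scoped Valued WithZero Matrix MatrixGroups
open Matrix

namespace Summit.HodgeConjecture.HodgeConjecture.Cruxes.H413.K2E3WittBoundedEntryTools

open Literature.NumberTheory.Automorphic

section Bounds

variable {K : Type*} [Field K] [Valued K ℤᵐ⁰] {n : ℕ}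

/-- **A matrix has entries bounded by some `exp c`, `c : ℕ`.** [folklore] -/
theorem exists_nat_forall_v_apply_le_exp (M : Matrix (Fin n) (Fin n) K) : ∃ c : ℕ, ∀ p q, Valued.v (M p q) ≤ WithZero.exp (c : ℤ) := by
  refine ⟨Finset.univ.sup fun pq : Fin n × Fin n => (WithZero.log (Valued.v (M pq.1 pq.2))).toNat, fun p q => ?_⟩
  by_cases h0 : Valued.v (M p q) = 0
  · rw [h0]; exact zero_le
  · rw [← WithZero.exp_log h0, WithZero.exp_le_exp]
    have h1 : (WithZero.log (Valued.v (M p q))).toNat ≤ Finset.univ.sup fun pq : Fin n × Fin n => (WithZero.log (Valued.v (M pq.1 pq.2))).toNat :=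
      Finset.le_sup (f := fun pq : Fin n × Fin n => (WithZero.log (Valued.v (M pq.1 pq.2))).toNat) (Finset.mem_univ (p, q))
    have h2 := Int.self_le_toNat (WithZero.log (Valued.v (M p q)))
    omega

/-- **Entries of a triple product are bounded by the product of the bounds** (ultrametric). [folklore] -/
theorem v_mul_mul_apply_le' {X Y Z : Matrix (Fin n) (Fin n) K} {a b c : ℤᵐ⁰} (hX : ∀ i j, Valued.v (X i j) ≤ a) (hY : ∀ i j, Valued.v (Y i j) ≤ b)
    (hZ : ∀ i j, Valued.v (Z i j) ≤ c) (i j : Fin n) : Valued.v ((X * Y * Z) i j) ≤ a * b * c := by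
  rw [Matrix.mul_apply]
  refine Valuation.map_sum_le _ fun l _ => ?_
  rw [map_mul, Matrix.mul_apply]
  refine mul_le_mul' (Valuation.map_sum_le _ fun k _ => ?_) (hZ l j)
  rw [map_mul]
  exact mul_le_mul' (hX i k) (hY k l)

omit [Valued K ℤᵐ⁰] in
/-- **`L⁻¹ = W⁻¹ σ(L)ᵀ W` for `L ∈ U(σ, W)`**, `det W ≠ 0` (matrix form). [cite: Rogawski1990, §1.9] -/
theorem coe_inv_eq_conj_witt {σ : K →+* K} {W : Matrix (Fin n) (Fin n) K} (hW : IsUnit W.det) (L : unitaryGroupOfForm σ W) :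
    (((L : GL (Fin n) K)⁻¹ : GL (Fin n) K) : Matrix (Fin n) (Fin n) K) = W⁻¹ * (((L : GL (Fin n) K) : Matrix (Fin n) (Fin n) K).map σ)ᵀ * W := by
  rw [Matrix.coe_units_inv]
  refine Matrix.inv_eq_left_inv ?_
  rw [Matrix.mul_assoc, Matrix.mul_assoc, ← Matrix.mul_assoc ((((L : GL (Fin n) K) : Matrix (Fin n) (Fin n) K).map σ)ᵀ), mem_unitaryGroupOfForm_iff.1 L.2,
    Matrix.nonsing_inv_mul _ hW]

/-- **A bounded element of `U(σ, W)` has a bounded inverse**: entries of `L ≤ B`, of `W`, `W⁻¹ ≤ c` ⇒ entries of `L⁻¹ ≤ c · B · c` (`v ∘ σ = v`).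
[cite: Rogawski1990, §1.9] [cite: BruhatTits1972, (4.4.3)] -/
theorem v_inv_apply_le_of_v_apply_le {σ : K →+* K} (hvσ : ∀ x, Valued.v (σ x) = Valued.v x) {W : Matrix (Fin n) (Fin n) K} (hW : IsUnit W.det)
    {cW B : ℤᵐ⁰} (hWle : ∀ p q, Valued.v (W p q) ≤ cW) (hWile : ∀ p q, Valued.v (W⁻¹ p q) ≤ cW) (L : unitaryGroupOfForm σ W)
    (hL : ∀ i j, Valued.v (((L : GL (Fin n) K) : Matrix (Fin n) (Fin n) K) i j) ≤ B) (i j : Fin n) :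
    Valued.v ((((L : GL (Fin n) K)⁻¹ : GL (Fin n) K) : Matrix (Fin n) (Fin n) K) i j) ≤ cW * B * cW := by
  rw [coe_inv_eq_conj_witt hW L]
  exact v_mul_mul_apply_le' hWile (fun i j => by rw [Matrix.transpose_apply, Matrix.map_apply, hvσ]; exact hL j i) hWle i j

end Bounds

end Summit.HodgeConjecture.HodgeConjecture.Cruxes.H413.K2E3WittBoundedEntryTools

end
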